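import Summits.ResolutionOfSingularities.ResolutionOfSingularities.Theorems.LossEntryW23
import HarnessLib

/-!
# LossEntryW24 (= lens-3 g29 slice 16) — walk plumbing of the loss→entry law — (AL′) order cascade and unique root

decomp-res-lens-3, gen 29 (NODE-g29 §3ter (AL′)).  TOOL at 0.  Imports `Theorems.LossEntryW23`.

§36 — FIRST LEMMAS OF THE (AL′) ALGEBRA (NODE-g29 §3ter (AL′)): the ORDER CASCADE **`le_degree_of_le_degree_mul`** (a factor with non-zero
constant coefficient cannot raise the order: if every monomial of `U·T` has degree `≥ s` and `U(0) ≠ 0` then every monomial of `T` has degree `≥ s`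
— (A3): with `U = (u_a + g_a)^M`, `g_a ≠ 0`, heaviness of the next state forces the translated wall form `H_v(x+g_a, 1, z+g_c)` to be homogeneous of
degree `s`), its monomial version `le_degree_of_le_degree_monomial_mul` (for the repeat, wall factor `u_a^M` kept), and (UNIQ)
**`eq_of_pure_power_eq`**: `c·(u_k − μu_l)^s = c′·(u_k − μ′u_l)^s`, `c ≠ 0`, `1 ≤ s` ⇒ `μ = μ′` in any characteristic (evaluation at `u_k = μ′`,
`u_l = 1`).
-/

open MvPolynomial Finset
open Literature.AlgebraicGeometry.Resolution
open Literature.AlgebraicGeometry.Resolution.Hauser2010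
open Literature.AlgebraicGeometry.Resolution.PointBlowup
open Summit.ResolutionOfSingularities.ResolutionOfSingularities.Theorems.TightDefectClasses
open Summit.ResolutionOfSingularities.ResolutionOfSingularities.Theorems.TightDefectStrongWalks
open Summit.ResolutionOfSingularities.ResolutionOfSingularities.Theorems.ItineraryCutClasses
open Summit.ResolutionOfSingularities.ResolutionOfSingularities.Theorems.BoundaryLedger
open Summit.ResolutionOfSingularities.ResolutionOfSingularities.Theorems.ProximityCut
open Summit.ResolutionOfSingularities.ResolutionOfSingularities.Theorems.LossExitCone
open Summit.ResolutionOfSingularities.ResolutionOfSingularities.Theorems.LossPolygon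

/-! ## §36 THE ORDER CASCADE (NODE-g29 §3ter (AL′)(A3)): a factor with non-zero constant term cannot raise the order -/

namespace Summit.ResolutionOfSingularities.ResolutionOfSingularities.Theorems.LossPolygon

variable {K : Type} [Field K]

section OrderCascade

variable {σ : Type}

/-- **ORDER CASCADE (PROVED; NODE-g29 §3ter (AL′)(A3)).**  If `U` has non-zero constant coefficient and every monomial of `U * T` has degree
`≥ s`, then every monomial of `T` has degree `≥ s` (a monomial of `T` of least degree survives in `U * T` with coefficient `U(0)·T_E`).  Used with
`U = (u_a + g_a)^M`, `g_a ≠ 0`, on the dehomogenised wall form: heaviness of the next state forces the translated in-wall form to be homogeneous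
of degree `s` («the centre direction is an `s`-fold point»). [new; elementary] -/
theorem le_degree_of_le_degree_mul (U T : MvPolynomial σ K) (hU : constantCoeff U ≠ 0) {s : ℕ}
    (h : ∀ E ∈ (U * T).support, s ≤ E.degree) : ∀ E ∈ T.support, s ≤ E.degree := by
  classical
  by_contra hcon
  push Not at hcon
  -- a monomial of `T` of least degree among those of degree `< s`
  have hne : (T.support.filter fun E => E.degree < s).Nonempty := by
    obtain ⟨E, hE, hEs⟩ := hcon
    exact ⟨E, Finset.mem_filter.mpr ⟨hE, hEs⟩⟩
  obtain ⟨E, hEmem, hEmin⟩ := Finset.exists_min_image _ (fun E : σ →₀ ℕ => E.degree) hne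
  obtain ⟨hET, hEs⟩ := Finset.mem_filter.mp hEmem
  have hmin : ∀ D ∈ T.support, D.degree < E.degree → False := by
    intro D hD hlt
    have := hEmin D (Finset.mem_filter.mpr ⟨hD, lt_trans hlt hEs⟩)
    omega
  -- the coefficient of `u^E` in `U * T` is `U(0) · T_E`
  have hcoeff : coeff E (U * T) = coeff 0 U * coeff E T := by
    rw [coeff_mul]
    rw [Finset.sum_eq_single (0, E)]
    · rintro ⟨D₁, D₂⟩ hx hne'
      have hsum : D₁ + D₂ = E := by simpa [Finset.mem_antidiagonal] using hx
      by_cases hD₂ : D₂ ∈ T.support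
      · -- then `D₂` has smaller degree than `E` unless `D₁ = 0`
        by_cases hD₁ : D₁ = 0
        · exfalso; apply hne'
          subst hD₁
          simp only [zero_add] at hsum
          subst hsum; rfl
        · exfalso
          have hdeg : E.degree = D₁.degree + D₂.degree := by rw [← hsum, map_add]
          have hpos : D₁.degree ≠ 0 := fun h0 => hD₁ ((Finsupp.degree_eq_zero_iff D₁).mp h0)
          exact hmin D₂ hD₂ (by omega)
      · rw [notMem_support_iff.mp hD₂, mul_zero]
    · intro h0
      exact absurd (by simp) h0
  have hmem : E ∈ (U * T).support := by
    rw [mem_support_iff, hcoeff]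
    exact mul_ne_zero (by rwa [← constantCoeff_eq]) (mem_support_iff.mp hET)
  have := h E hmem
  omega

/-- Monomial version of the cascade (for the repeat, where the wall factor `u_a^M` is kept): if every monomial of `monomial D c * T` (`c ≠ 0`)
has degree `≥ s + |D|`, then every monomial of `T` has degree `≥ s`. [new; elementary] -/
theorem le_degree_of_le_degree_monomial_mul (D : σ →₀ ℕ) {c : K} (hc : c ≠ 0) (T : MvPolynomial σ K) {s : ℕ}
    (h : ∀ E ∈ (monomial D c * T).support, s + D.degree ≤ E.degree) : ∀ E ∈ T.support, s ≤ E.degree := by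
  classical
  intro E hE
  have hmem : D + E ∈ (monomial D c * T).support := by
    rw [mem_support_iff, coeff_monomial_mul']
    simp only [le_add_iff_nonneg_right, zero_le, add_tsub_cancel_left, if_true]
    exact mul_ne_zero hc (mem_support_iff.mp hE)
  have := h (D + E) hmem
  rw [map_add] at this
  omega

end OrderCascade

section UniqueRoot

/-- **UNIQUE ROOT OF A PURE POWER (PROVED; NODE-g29 §3ter (AL′)(UNIQ)), any characteristic.**  If
`c·(u_k − μ u_l)^s = c′·(u_k − μ′ u_l)^s` with `c ≠ 0`, `1 ≤ s`, `k ≠ l`, then `μ = μ′` (evaluate at `u_k = μ′`, `u_l = 1`). [new; elementary] -/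
theorem eq_of_pure_power_eq {k l : Fin 3} (hkl : k ≠ l) {s : ℕ} (hs : 1 ≤ s) {c c' μ μ' : K} (hc : c ≠ 0)
    (h : C c * (X k - C μ * X l) ^ s = C c' * (X k - C μ' * X l) ^ s) : μ = μ' := by
  classical
  -- evaluate both sides at the point `u_k = μ'`, `u_l = 1` (other coordinate `0`)
  have hev := congrArg (MvPolynomial.eval (fun i => if i = k then μ' else if i = l then (1 : K) else 0)) h
  simp only [map_mul, map_pow, map_sub, eval_C, eval_X, if_true, if_neg hkl.symm, mul_one, sub_self] at hev
  have hs0 : s ≠ 0 := by omega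
  rw [zero_pow hs0, mul_zero] at hev
  -- `c · (μ' − μ)^s = 0`
  have h1 : (μ' - μ) ^ s = 0 := by
    rcases mul_eq_zero.mp hev with h | h
    · exact absurd h hc
    · exact h
  have h2 : μ' - μ = 0 := pow_eq_zero_iff hs0 |>.mp h1
  exact (sub_eq_zero.mp h2).symm

end UniqueRoot

end Summit.ResolutionOfSingularities.ResolutionOfSingularities.Theorems.LossPolygon
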